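import Summits.QuantumFields.BalabanUV.Beta.GAN24.Push4NestAux
import Summits.QuantumFields.BalabanUV.Beta.GAN24.Push4NestTable
import Summits.QuantumFields.BalabanUV.Beta.GAN24.Push4LocStencil

/-!
# `BalabanUV.Beta.GAN24.Push4Nest` — binder row G-an2-4 / (CONV-C), W-slot road «W3» (SKELETON-W3 v0.2 §2 W3-L1 / §7.4 (F1)): THE FOUR-LEG PUSH
# NESTS — `push₄ l₁ r₁ (push₄ l₂ r₂ X) = push₄ (legComp l₂ l₁) (legComp r₂ r₁) X` (the `PushSumNest.pushSum_pushSum` twin one order up)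

NOT IN PRINT; OUR PROOF ATTEMPT (G-an2-4 formalisation swarm, leaf prover `b2b-balaban-gan24-formalise-leaf-17`, gen 14; the row owner gan24-p1-g5's
RULINGS-12 (R12-7) invitation «W3-L1 `Push4Nest`»; names PROVISIONAL).  HONEST FRAMING (cell contract, verbatim): «discharging `BetaPertH` makes Bałaban's UV
stability UNCONDITIONAL — a real constructive-QFT result; it is NOT the continuum limit and NOT the Clay problem.»  HONEST DEPENDENCY (verbatim): «continuum YM
on T⁴ ⇐ BetaPertH ∧ nine spine estimates (0/9 proved); BetaPertH ⇐ (D1) ∧ (D4) ∧ CAP+tail; G-an2-4 gates asym, D1 and NE2/3/4.»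

WHAT.  For leg families localised at positive rates (`Push4Bounds.LegDecay`: the outer pair `(l₁, r₁)` at blocking `N₁`, the inner pair `(l₂, r₂)` at blocking
`N₂`) and a bi-stencil table `X` in `LocStencil₂` at a positive rate, the push of the push is ONE push through the COMPOSITE legs:
**`push₄_push₄ : push₄ l₁ r₁ (push₄ l₂ r₂ X) μ y ν y′ = push₄ (legComp l₂ l₁) (legComp r₂ r₁) X μ y ν y′`** (composite blocking `N₂·N₁`).  Consequently the
`k`-fold iterate of the linear part of an2's `T2Of` recursion is a SINGLE four-leg push through `legComp`-chains of the `rowM`/`colH` families of the normalised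
step resolvents (`Push4.mmRead_sandwich_vertex2OfK_eq_push₄`), whose identification with an4's composite response columns is BCJ's (K1b′)
(`vertexOf_eq_transportV`, `respStep_eq`) — the `T2UnitSplit*` step (leaf-01 lineage, `AffineUnroll`), not here.
HOW.  Table legs: `Push4NestTable` (`vertexW_ffRead`, `vertexW_comp_right`, `vertexW_comp_left`, `vertexW_comm`, `vertexW_vertexW`) give
**`vertex2W_push₄`** — the outer table legs pass through the inner kernel legs
and merge with the inner table legs (`= ffRead (Lk l₂ ∘ vertex2W (legComp r₂ r₁) X ∘ Rk r₂)`); kernel legs: `Push4NestAux.sandwich_ffRead` drops the inner ff-read, three dominated re-associations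
(`KernelWard.comp_assoc_of_bound`, majorants from `Push4LocStencil.abs_comp_Lk_le` / `Push4Bounds.biLoc_vertex2W_keep` / `Push4NestAux.legDecay_legComp`)
and `Push4.comp_Lk_Lk` / `comp_Rk_Rk` merge the kernel legs (`sandwich_nest`).  Every interchange is justified by exponential majorants derived from the
hypotheses; no rate or constant enters the STATEMENT.
[folklore]; 0 cited facts, 0 `Prop` mirrors, 0 definitions, 0 sorry.  Asserts NO shape of Bałaban's tables; «T2Shape» / «T2SupRate» LOCATED / OPEN, NOT IN
PRINT; discharges NOTHING of (hW, hWall); 0 wall binders instantiated; NOT «W-slot closed», NEVER «G-an2-4 closed»; NOT BetaPertH, NOT continuum, NOT Clay.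
-/

noncomputable section

open Finset
open scoped BigOperators
open Literature.MathematicalPhysics.QuantumFieldTheory
open Literature.MathematicalPhysics.QuantumFieldTheory.Balaban1983to89
open Literature.MathematicalPhysics.QuantumFieldTheory.Balaban1983to89.Beta
open B12Sec2to5 (l1 l1_nonneg)
open ExpKernelCalculus (MKer Decays BiLoc comp Zl Zl_nonneg l1_sub_triangle l1_sub_symm l1_natSmul summable_exp_shift summable_exp_shift'
  tsum_exp_shift tsum_exp_shift')
open OneStepResolventKernel (Fib wsum LocStencil biLoc_mono)
open KernelWard (comp_assoc_of_bound)
open BalabanCompositeJets (LocStencil₂ summable_slice_of_locStencil₂)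
open Summit.QuantumFields.BalabanUV.Beta.GAN24.Push4 (legComp legComp_apply vertexW vertexW_apply vertex2W Lk Rk ffRead push₄
  Lk_inl_inl Lk_inl_inr Lk_inr Rk_inl_inl Rk_inr_left Rk_inr_right ffRead_inl_inl ffRead_inr_left ffRead_inr_right push₄_def comp_Lk_Lk comp_Rk_Rk)
open Summit.QuantumFields.BalabanUV.Beta.GAN24.Push4Bounds (LegDecay LegDecay.nonneg LegDecay.abs_le LegDecay.summable biLoc_vertex2W_keep)
open Summit.QuantumFields.BalabanUV.Beta.GAN24.Push4LocStencil (abs_comp_Lk_le)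
open Summit.QuantumFields.BalabanUV.Beta.GAN24.Push4NestTable (vertexW_ffRead vertexW_congr vertexW_vertexW vertexW_comp_left vertexW_comp_right
  vertexW_comm)
open Summit.QuantumFields.BalabanUV.Beta.GAN24.Push4NestAux (abs_vertexW_slice_le summable_vertexW_slice decays_vertexW_of_locStencil
  decays_vertex2W_of_bdd abs_le_of_decays abs_comp_Lk_le_of_decays summable_Lk_row summable_Rk_col legDecay_legComp sandwich_ffRead)

namespace Summit.QuantumFields.BalabanUV.Beta.GAN24.Push4Nest

variable {d : ℕ}
variable {l₁ r₁ l₂ r₂ : Fin (d + 1) → (Fin (d + 1) → ℤ) → Fin (d + 1) → (Fin (d + 1) → ℤ) → ℝ} {N₁ N₂ : ℕ}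
  {Cl₁ Cr₁ Cl₂ Cr₂ m₁ m₂ C δ : ℝ}
  {X : Fin (d + 1) → (Fin (d + 1) → ℤ) → Fin (d + 1) → (Fin (d + 1) → ℤ) → MKer (d + 1) (Fib d)}

/-! ## §1 Leg-kernel entry bounds -/

/-- [folklore] Entries of a left leg kernel are bounded by the leg family's localisation bound. -/
theorem abs_Lk_le {l : Fin (d + 1) → (Fin (d + 1) → ℤ) → Fin (d + 1) → (Fin (d + 1) → ℤ) → ℝ} {N : ℕ} {Cl m : ℝ}
    (hl : LegDecay l N Cl m) (x'' x' : Fin (d + 1) → ℤ) (a f : Fib d) :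
    |Lk l x'' x' a f| ≤ Cl * Real.exp (-m * l1 (x' - (N : ℤ) • x'')) := by
  have := hl.nonneg
  rcases a with α | μ
  · rcases f with κ | ν
    · rw [Lk_inl_inl]; exact hl α x'' κ x'
    · rw [Lk_inl_inr, abs_zero]; positivity
  · rw [Lk_inr, abs_zero]; positivity

/-- [folklore] Entries of a right leg kernel are bounded by the leg family's localisation bound. -/
theorem abs_Rk_le {r : Fin (d + 1) → (Fin (d + 1) → ℤ) → Fin (d + 1) → (Fin (d + 1) → ℤ) → ℝ} {N : ℕ} {Cr m : ℝ}
    (hr : LegDecay r N Cr m) (z z' : Fin (d + 1) → ℤ) (f b : Fib d) :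
    |Rk r z z' f b| ≤ Cr * Real.exp (-m * l1 (z - (N : ℤ) • z')) := by
  have := hr.nonneg
  rcases f with κ | μ
  · rcases b with β | ν
    · rw [Rk_inl_inl]; exact hr β z' κ z
    · rw [Rk_inr_right, abs_zero]; positivity
  · rw [Rk_inr_left, abs_zero]; positivity

/-- [folklore] Entries of a left leg kernel are bounded by a uniform bound of the legs. -/
theorem abs_Lk_le_bdd {l : Fin (d + 1) → (Fin (d + 1) → ℤ) → Fin (d + 1) → (Fin (d + 1) → ℤ) → ℝ} {Cl : ℝ}
    (hl : ∀ α x'' κ x', |l α x'' κ x'| ≤ Cl) (hCl : 0 ≤ Cl) (x'' x' : Fin (d + 1) → ℤ) (a f : Fib d) : |Lk l x'' x' a f| ≤ Cl := by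
  rcases a with α | μ
  · rcases f with κ | ν
    · rw [Lk_inl_inl]; exact hl α x'' κ x'
    · rw [Lk_inl_inr, abs_zero]; exact hCl
  · rw [Lk_inr, abs_zero]; exact hCl

/-- [folklore] Entries of a right leg kernel are bounded by a uniform bound of the legs. -/
theorem abs_Rk_le_bdd {r : Fin (d + 1) → (Fin (d + 1) → ℤ) → Fin (d + 1) → (Fin (d + 1) → ℤ) → ℝ} {Cr : ℝ}
    (hr : ∀ β z' κ z, |r β z' κ z| ≤ Cr) (hCr : 0 ≤ Cr) (z z' : Fin (d + 1) → ℤ) (f b : Fib d) : |Rk r z z' f b| ≤ Cr := by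
  rcases f with κ | μ
  · rcases b with β | ν
    · rw [Rk_inl_inl]; exact hr β z' κ z
    · rw [Rk_inr_right, abs_zero]; exact hCr
  · rw [Rk_inr_left, abs_zero]; exact hCr

/-! ## §2 The table legs of the nest: `vertex2W r₁ (push₄ l₂ r₂ X) = push₄ l₂ (legComp r₂ r₁) X` -/

/-- [folklore] **THE OUTER TABLE LEGS PASS THROUGH THE INNER PUSH AND MERGE WITH ITS TABLE LEGS**:
`vertex2W r₁ (push₄ l₂ r₂ X) μ y ν y′ = ffRead (Lk l₂ ∘ vertex2W (legComp r₂ r₁) X μ y ν y′ ∘ Rk r₂)` — the table legs are already composite, the kernel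
legs still the inner ones. -/
theorem vertex2W_push₄ (hr₁ : LegDecay r₁ N₁ Cr₁ m₁) (hl₂ : LegDecay l₂ N₂ Cl₂ m₂) (hr₂ : LegDecay r₂ N₂ Cr₂ m₂) (hm₁ : 0 < m₁) (hm₂ : 0 < m₂)
    (hX : LocStencil₂ X C δ) (hδ : 0 < δ) (μ : Fin (d + 1)) (y : Fin (d + 1) → ℤ) (ν : Fin (d + 1)) (y' : Fin (d + 1) → ℤ) :
    vertex2W r₁ (push₄ l₂ r₂ X) μ y ν y' = ffRead (comp (comp (Lk l₂) (vertex2W (legComp r₂ r₁) X μ y ν y')) (Rk r₂)) := by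
  -- data
  have hC := hX.nonneg
  have hCr₁ := hr₁.nonneg
  have hCl₂ := hl₂.nonneg
  have hCr₂ := hr₂.nonneg
  have hZδ := Zl_nonneg (D := d + 1) hδ
  have hZδ2 := Zl_nonneg (D := d + 1) (half_pos hδ)
  have hr₁s : ∀ μ₀ y₀ lam, Summable fun v => r₁ μ₀ y₀ lam v := fun μ₀ y₀ lam => hr₁.summable hm₁ μ₀ y₀ lam
  have hr₂b : ∀ lam v κ u, |r₂ lam v κ u| ≤ Cr₂ := fun lam v κ u => hr₂.abs_le hm₂.le lam v κ u
  have hl₂b : ∀ α x' κ x, |l₂ α x' κ x| ≤ Cl₂ := fun α x' κ x => hl₂.abs_le hm₂.le α x' κ x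
  have hl₂s : ∀ α x' κ, Summable fun x => l₂ α x' κ x := fun α x' κ => hl₂.summable hm₂ α x' κ
  have hr₂s : ∀ β z' κ, Summable fun z => r₂ β z' κ z := fun β z' κ => hr₂.summable hm₂ β z' κ
  -- the composite table legs: localised (Push4NestAux.legDecay_legComp), hence bounded
  set R := legComp r₂ r₁ with hRdef
  obtain ⟨m', hm'0, hm'₂, hm'₁⟩ : ∃ m' : ℝ, 0 < m' ∧ m' ≤ m₂ ∧ m' * N₂ < m₁ := by
    refine ⟨min m₂ (m₁ / (2 * ((N₂ : ℝ) + 1))), lt_min hm₂ (by positivity), min_le_left _ _, ?_⟩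
    have hN : (0 : ℝ) ≤ N₂ := Nat.cast_nonneg _
    have hpos : (0 : ℝ) < 2 * ((N₂ : ℝ) + 1) := by positivity
    have h1 : min m₂ (m₁ / (2 * ((N₂ : ℝ) + 1))) * N₂ ≤ m₁ / (2 * ((N₂ : ℝ) + 1)) * N₂ :=
      mul_le_mul_of_nonneg_right (min_le_right _ _) hN
    have h2 : m₁ / (2 * ((N₂ : ℝ) + 1)) * N₂ < m₁ := by
      calc m₁ / (2 * ((N₂ : ℝ) + 1)) * N₂ < m₁ / (2 * ((N₂ : ℝ) + 1)) * (2 * ((N₂ : ℝ) + 1)) :=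
            mul_lt_mul_of_pos_left (by linarith) (div_pos hm₁ hpos)
        _ = m₁ := div_mul_cancel₀ _ hpos.ne'
    exact h1.trans_lt h2
  have hR : LegDecay R (N₂ * N₁) ((d + 1 : ℕ) * (Cr₁ * Cr₂ * Zl (d + 1) (m₁ - m' * N₂))) m' :=
    legDecay_legComp hr₁ hr₂ hm'0.le hm'₂ hm'₁
  set CR : ℝ := (d + 1 : ℕ) * (Cr₁ * Cr₂ * Zl (d + 1) (m₁ - m' * N₂)) with hCRdef
  have hCR : 0 ≤ CR := hR.nonneg
  have hRb : ∀ μ₀ y₀ κ u, |R μ₀ y₀ κ u| ≤ CR := fun μ₀ y₀ κ u => hR.abs_le hm'0.le μ₀ y₀ κ u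
  -- the inner vertex family `G κ u l' v' := vertexW r₂ (X κ u) l' v'` and the inner second-order vertex `V`
  set V := vertex2W r₂ X with hVdef
  have hVdec : ∀ lam v l' v', Decays (V lam v l' v')
      ((d + 1 : ℕ) * (Cr₂ * ((d + 1 : ℕ) * (Cr₂ * (C * Zl (d + 1) δ))) * Zl (d + 1) (δ / 2))) (δ / 2) :=
    fun lam v l' v' => decays_vertex2W_of_bdd (fun μ₀ y₀ κ u => hr₂b μ₀ y₀ κ u) hCr₂ hX hδ lam v l' v'
  -- STEP A1 (inner, at a fixed middle bond `(lam, v)`)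
  have A1 : ∀ (lam : Fin (d + 1)) (v : Fin (d + 1) → ℤ),
      vertexW r₁ (fun l' v' => push₄ l₂ r₂ X lam v l' v') ν y'
        = ffRead (comp (comp (Lk l₂) (vertexW r₂ (fun κ u => vertexW R (X κ u) ν y') lam v)) (Rk r₂)) := by
    intro lam v
    -- through the inner `ffRead`
    have e0 : (fun l' v' => push₄ l₂ r₂ X lam v l' v') = fun l' v' => ffRead (comp (comp (Lk l₂) (V lam v l' v')) (Rk r₂)) := rfl
    rw [e0, vertexW_ffRead]
    congr 1
    -- through the inner right leg kernel
    have e1 : vertexW r₁ (fun l' v' => comp (comp (Lk l₂) (V lam v l' v')) (Rk r₂)) ν y'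
        = comp (vertexW r₁ (fun l' v' => comp (Lk l₂) (V lam v l' v')) ν y') (Rk r₂) :=
      vertexW_comp_right (hr₁s ν y') (fun z f b => summable_Rk_col hr₂s z f b)
        (fun l' v' x w a f => abs_comp_Lk_le_of_decays hl₂b hCl₂ (hVdec lam v l' v') (half_pos hδ) x w a f)
    rw [e1]
    congr 1
    -- through the inner left leg kernel
    have e2 : vertexW r₁ (fun l' v' => comp (Lk l₂) (V lam v l' v')) ν y' = comp (Lk l₂) (vertexW r₁ (fun l' v' => V lam v l' v') ν y') :=
      vertexW_comp_left (hr₁s ν y') (fun x a f => summable_Lk_row hl₂s x a f)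
        (fun l' v' w z f b => abs_le_of_decays (hVdec lam v l' v') (half_pos hδ).le w z f b)
    rw [e2]
    congr 1
    -- past the inner table leg on the first slot, then merge on the second slot
    have e3 : vertexW r₁ (fun l' v' => V lam v l' v') ν y'
        = vertexW r₂ (fun κ u => vertexW r₁ (fun l' v' => vertexW r₂ (X κ u) l' v') ν y') lam v := by
      have hG : ∀ κ x z a b, ∃ g : (Fin (d + 1) → ℤ) → ℝ, Summable g ∧
          ∀ u l' v', |vertexW r₂ (X κ u) l' v' x z a b| ≤ g u := by
        intro κ x z a b
        refine ⟨fun u => (d + 1 : ℕ) * (Cr₂ * (C * Zl (d + 1) δ)) * Real.exp (-δ * (l1 (x - u) + l1 (z - u))), ?_,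
          fun u l' v' => abs_vertexW_slice_le (fun μ₀ y₀ κ u => hr₂b μ₀ y₀ κ u) hCr₂ hX hδ κ u l' v' x z a b⟩
        refine Summable.of_nonneg_of_le (fun u => by positivity) (fun u => ?_)
          ((summable_exp_shift hδ x).mul_left ((d + 1 : ℕ) * (Cr₂ * (C * Zl (d + 1) δ))))
        refine mul_le_mul_of_nonneg_left (Real.exp_le_exp.2 ?_) (by positivity)
        nlinarith [l1_nonneg (z - u), l1_nonneg (x - u)]
      exact vertexW_comm (hr₁s ν y') (fun κ u => hr₂b lam v κ u) hG
    rw [e3]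
    exact vertexW_congr (fun κ u => vertexW_vertexW (hr₁s ν y') hr₂b
      (fun κ' x z a b => summable_slice_of_locStencil₂ hX hδ κ u κ' x z a b)) lam v
  -- STEP A2 (outer): the family of inner results
  set G' : Fin (d + 1) → (Fin (d + 1) → ℤ) → MKer (d + 1) (Fib d) := fun κ u => vertexW R (X κ u) ν y' with hG'def
  have hG'loc : LocStencil G' ((d + 1 : ℕ) * (CR * (C * Zl (d + 1) δ))) δ := fun κ u x z a b =>
    abs_vertexW_slice_le hRb hCR hX hδ κ u ν y' x z a b
  set H : Fin (d + 1) → (Fin (d + 1) → ℤ) → MKer (d + 1) (Fib d) := fun lam v => vertexW r₂ G' lam v with hHdef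
  have hHdec : ∀ lam v, Decays (H lam v) ((d + 1 : ℕ) * (Cr₂ * ((d + 1 : ℕ) * (CR * (C * Zl (d + 1) δ))) * Zl (d + 1) (δ / 2))) (δ / 2) :=
    fun lam v => decays_vertexW_of_locStencil (fun μ₀ y₀ κ u => hr₂b μ₀ y₀ κ u) hCr₂ hG'loc hδ lam v
  have eA : vertex2W r₁ (push₄ l₂ r₂ X) μ y ν y' = vertexW r₁ (fun lam v => ffRead (comp (comp (Lk l₂) (H lam v)) (Rk r₂))) μ y :=
    vertexW_congr (fun lam v => A1 lam v) μ y
  rw [eA, vertexW_ffRead]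
  congr 1
  have e1 : vertexW r₁ (fun lam v => comp (comp (Lk l₂) (H lam v)) (Rk r₂)) μ y
      = comp (vertexW r₁ (fun lam v => comp (Lk l₂) (H lam v)) μ y) (Rk r₂) :=
    vertexW_comp_right (hr₁s μ y) (fun z f b => summable_Rk_col hr₂s z f b)
      (fun lam v x w a f => abs_comp_Lk_le_of_decays hl₂b hCl₂ (hHdec lam v) (half_pos hδ) x w a f)
  rw [e1]
  congr 1
  have e2 : vertexW r₁ (fun lam v => comp (Lk l₂) (H lam v)) μ y = comp (Lk l₂) (vertexW r₁ H μ y) :=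
    vertexW_comp_left (hr₁s μ y) (fun x a f => summable_Lk_row hl₂s x a f)
      (fun lam v w z f b => abs_le_of_decays (hHdec lam v) (half_pos hδ).le w z f b)
  rw [e2]
  congr 1
  -- merge the outer table legs with the composite inner ones: `vertexW r₁ (vertexW r₂ G') = vertexW R G' = vertex2W R X`
  exact vertexW_vertexW (hr₁s μ y) hr₂b (fun κ x z a b => summable_vertexW_slice hRb hCR hX hδ κ ν y' x z a b)

/-! ## §3 The kernel legs of the nest: three dominated re-associations -/

/-- [folklore] **THE KERNEL LEGS MERGE**: for leg families localised at positive rates and a middle kernel bi-localised at the composite dilated point,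
`comp (comp (Lk l₁) (comp (comp (Lk l₂) W) (Rk r₂))) (Rk r₁) = comp (comp (Lk (legComp l₂ l₁)) W) (Rk (legComp r₂ r₁))`
(`KernelWard.comp_assoc_of_bound` three times, `Push4.comp_Lk_Lk` / `comp_Rk_Rk`). -/
theorem sandwich_nest (hl₁ : LegDecay l₁ N₁ Cl₁ m₁) (hr₁ : LegDecay r₁ N₁ Cr₁ m₁) (hl₂ : LegDecay l₂ N₂ Cl₂ m₂) (hr₂ : LegDecay r₂ N₂ Cr₂ m₂)
    (hm₁ : 0 < m₁) (hm₂ : 0 < m₂) {CL mL : ℝ} (hL : LegDecay (legComp l₂ l₁) (N₂ * N₁) CL mL)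
    {W : MKer (d + 1) (Fib d)} {CW δW : ℝ} {y : Fin (d + 1) → ℤ}
    (hW : BiLoc W (((N₂ * N₁ : ℕ) : ℤ) • y) (((N₂ * N₁ : ℕ) : ℤ) • y) CW δW) (hδW : 0 < δW) (hδ₂ : δW < m₂) (hδL : δW < mL) :
    comp (comp (Lk l₁) (comp (comp (Lk l₂) W) (Rk r₂))) (Rk r₁) = comp (comp (Lk (legComp l₂ l₁)) W) (Rk (legComp r₂ r₁)) := by
  have hCl₁ := hl₁.nonneg
  have hCr₁ := hr₁.nonneg
  have hCl₂ := hl₂.nonneg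
  have hCr₂ := hr₂.nonneg
  have hCL := hL.nonneg
  have hCW : 0 ≤ CW := hW.nonneg (Sum.inl 0)
  have hr₂b : ∀ β z' κ z, |r₂ β z' κ z| ≤ Cr₂ := fun β z' κ z => hr₂.abs_le hm₂.le β z' κ z
  have hl₂b : ∀ α x'' κ x', |l₂ α x'' κ x'| ≤ Cl₂ := fun α x'' κ x' => hl₂.abs_le hm₂.le α x'' κ x'
  have ep : ((N₂ * N₁ : ℕ) : ℤ) • y = (N₂ : ℤ) • ((N₁ : ℤ) • y) := by rw [Nat.cast_mul, mul_smul]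
  have hZ2 : 0 ≤ Zl (d + 1) (m₂ - δW) := Zl_nonneg (by linarith)
  have hZL : 0 ≤ Zl (d + 1) (mL - δW) := Zl_nonneg (by linarith)
  -- the middle kernel seen through the inner left leg decays in its (fine) right index from the composite point
  have hW' : BiLoc W ((N₂ : ℤ) • ((N₁ : ℤ) • y)) ((N₂ : ℤ) • ((N₁ : ℤ) • y)) CW δW := by rw [← ep]; exact hW
  have hM : ∀ x' z f g, |comp (Lk l₂) W x' z f g|
      ≤ (d + 1 : ℕ) * (Cl₂ * CW * Zl (d + 1) (m₂ - δW)) * Real.exp (-δW * l1 (z - ((N₂ * N₁ : ℕ) : ℤ) • y)) := by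
    intro x' z f g
    refine (abs_comp_Lk_le hl₂ hW' hδW.le hδ₂ x' z f g).trans ?_
    rw [← ep]
    refine mul_le_mul_of_nonneg_left (Real.exp_le_exp.2 ?_) (by positivity)
    nlinarith [l1_nonneg ((N₂ : ℤ) • x' - ((N₂ * N₁ : ℕ) : ℤ) • y)]
  -- the middle kernel seen through the COMPOSITE left leg decays in its right index from the composite point
  have hP : ∀ x'' z f g, |comp (Lk (legComp l₂ l₁)) W x'' z f g|
      ≤ (d + 1 : ℕ) * (CL * CW * Zl (d + 1) (mL - δW)) * Real.exp (-δW * l1 (z - ((N₂ * N₁ : ℕ) : ℤ) • y)) := by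
    intro x'' z f g
    refine (abs_comp_Lk_le hL hW hδW.le hδL x'' z f g).trans ?_
    refine mul_le_mul_of_nonneg_left (Real.exp_le_exp.2 ?_) (by positivity)
    nlinarith [l1_nonneg (((N₂ * N₁ : ℕ) : ℤ) • x'' - ((N₂ * N₁ : ℕ) : ℤ) • y)]
  -- (b) `Lk l₁ ∘ (Lk l₂ ∘ W) = (Lk l₁ ∘ Lk l₂) ∘ W`
  have assoc_b : comp (Lk l₁) (comp (Lk l₂) W) = comp (comp (Lk l₁) (Lk l₂)) W := by
    refine comp_assoc_of_bound fun x'' z a b => ?_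
    refine ⟨fun x' => Cl₁ * Real.exp (-m₁ * l1 (x' - (N₁ : ℤ) • x'')),
      fun x => Cl₂ * (CW * Real.exp (-δW * l1 (x - ((N₂ * N₁ : ℕ) : ℤ) • y))),
      (summable_exp_shift' hm₁ _).mul_left Cl₁, ((summable_exp_shift' hδW _).mul_left CW).mul_left Cl₂,
      fun x' => by positivity, fun x => by positivity, fun x' x f g => ?_⟩
    rw [abs_mul, abs_mul]
    have h3 : |W x z g b| ≤ CW * Real.exp (-δW * l1 (x - ((N₂ * N₁ : ℕ) : ℤ) • y)) := by
      refine (hW x z g b).trans (mul_le_mul_of_nonneg_left (Real.exp_le_exp.2 ?_) hCW)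
      nlinarith [l1_nonneg (z - ((N₂ * N₁ : ℕ) : ℤ) • y), l1_nonneg (x - ((N₂ * N₁ : ℕ) : ℤ) • y)]
    calc |Lk l₁ x'' x' a f| * |Lk l₂ x' x f g| * |W x z g b|
        ≤ (Cl₁ * Real.exp (-m₁ * l1 (x' - (N₁ : ℤ) • x''))) * Cl₂ * (CW * Real.exp (-δW * l1 (x - ((N₂ * N₁ : ℕ) : ℤ) • y))) :=
          mul_le_mul (mul_le_mul (abs_Lk_le hl₁ x'' x' a f) (abs_Lk_le_bdd hl₂b hCl₂ x' x f g) (abs_nonneg _) (by positivity))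
            h3 (abs_nonneg _) (by positivity)
      _ = _ := by ring
  -- (a) `Lk l₁ ∘ ((Lk l₂ ∘ W) ∘ Rk r₂) = (Lk l₁ ∘ (Lk l₂ ∘ W)) ∘ Rk r₂`
  have assoc_a : comp (Lk l₁) (comp (comp (Lk l₂) W) (Rk r₂)) = comp (comp (Lk l₁) (comp (Lk l₂) W)) (Rk r₂) := by
    refine comp_assoc_of_bound fun x'' z' a b => ?_
    refine ⟨fun x' => Cl₁ * Real.exp (-m₁ * l1 (x' - (N₁ : ℤ) • x'')),
      fun z => (d + 1 : ℕ) * (Cl₂ * CW * Zl (d + 1) (m₂ - δW)) * Real.exp (-δW * l1 (z - ((N₂ * N₁ : ℕ) : ℤ) • y)) * Cr₂,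
      (summable_exp_shift' hm₁ _).mul_left Cl₁, ((summable_exp_shift' hδW _).mul_left _).mul_right Cr₂,
      fun x' => by positivity, fun z => by positivity, fun x' z f g => ?_⟩
    rw [abs_mul, abs_mul]
    calc |Lk l₁ x'' x' a f| * |comp (Lk l₂) W x' z f g| * |Rk r₂ z z' g b|
        ≤ (Cl₁ * Real.exp (-m₁ * l1 (x' - (N₁ : ℤ) • x''))) *
            ((d + 1 : ℕ) * (Cl₂ * CW * Zl (d + 1) (m₂ - δW)) * Real.exp (-δW * l1 (z - ((N₂ * N₁ : ℕ) : ℤ) • y))) * Cr₂ :=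
          mul_le_mul (mul_le_mul (abs_Lk_le hl₁ x'' x' a f) (hM x' z f g) (abs_nonneg _) (by positivity))
            (abs_Rk_le_bdd hr₂b hCr₂ z z' g b) (abs_nonneg _) (by positivity)
      _ = _ := by ring
  -- (c) `(Lk L ∘ W) ∘ (Rk r₂ ∘ Rk r₁) = ((Lk L ∘ W) ∘ Rk r₂) ∘ Rk r₁`
  have assoc_c : comp (comp (Lk (legComp l₂ l₁)) W) (comp (Rk r₂) (Rk r₁))
      = comp (comp (comp (Lk (legComp l₂ l₁)) W) (Rk r₂)) (Rk r₁) := by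
    refine comp_assoc_of_bound fun x'' z'' a b => ?_
    refine ⟨fun z => (d + 1 : ℕ) * (CL * CW * Zl (d + 1) (mL - δW)) * Real.exp (-δW * l1 (z - ((N₂ * N₁ : ℕ) : ℤ) • y)) * Cr₂,
      fun z' => Cr₁ * Real.exp (-m₁ * l1 (z' - (N₁ : ℤ) • z'')),
      ((summable_exp_shift' hδW _).mul_left _).mul_right Cr₂, (summable_exp_shift' hm₁ _).mul_left Cr₁,
      fun z => by positivity, fun z' => by positivity, fun z z' g h => ?_⟩
    rw [abs_mul, abs_mul]
    calc |comp (Lk (legComp l₂ l₁)) W x'' z a g| * |Rk r₂ z z' g h| * |Rk r₁ z' z'' h b|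
        ≤ ((d + 1 : ℕ) * (CL * CW * Zl (d + 1) (mL - δW)) * Real.exp (-δW * l1 (z - ((N₂ * N₁ : ℕ) : ℤ) • y))) * Cr₂ *
            (Cr₁ * Real.exp (-m₁ * l1 (z' - (N₁ : ℤ) • z''))) :=
          mul_le_mul (mul_le_mul (hP x'' z a g) (abs_Rk_le_bdd hr₂b hCr₂ z z' g h) (abs_nonneg _) (by positivity))
            (abs_Rk_le hr₁ z' z'' h b) (abs_nonneg _) (by positivity)
      _ = _ := by ring
  -- assemble
  rw [assoc_a, assoc_b, comp_Lk_Lk, ← assoc_c, comp_Rk_Rk]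

/-! ## §4 The nesting law -/

/-- [folklore] **THE FOUR-LEG PUSH NESTS.**  For leg families localised at positive rates — the OUTER pair `(l₁, r₁)` at blocking `N₁`, the INNER pair
`(l₂, r₂)` at blocking `N₂` — and a bi-stencil table `X` in `LocStencil₂` at a positive rate:
`push₄ l₁ r₁ (push₄ l₂ r₂ X) μ y ν y′ = push₄ (legComp l₂ l₁) (legComp r₂ r₁) X μ y ν y′` (composite blocking `N₂·N₁`; the `PushSumNest.pushSum_pushSum`
twin one order up).  No rate or constant enters the statement. -/
theorem push₄_push₄ (hl₁ : LegDecay l₁ N₁ Cl₁ m₁) (hr₁ : LegDecay r₁ N₁ Cr₁ m₁) (hl₂ : LegDecay l₂ N₂ Cl₂ m₂) (hr₂ : LegDecay r₂ N₂ Cr₂ m₂)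
    (hm₁ : 0 < m₁) (hm₂ : 0 < m₂) (hX : LocStencil₂ X C δ) (hδ : 0 < δ) (μ : Fin (d + 1)) (y : Fin (d + 1) → ℤ) (ν : Fin (d + 1))
    (y' : Fin (d + 1) → ℤ) :
    push₄ l₁ r₁ (push₄ l₂ r₂ X) μ y ν y' = push₄ (legComp l₂ l₁) (legComp r₂ r₁) X μ y ν y' := by
  have hCr₁ := hr₁.nonneg
  have hCr₂ := hr₂.nonneg
  -- a common composite rate
  obtain ⟨m', hm'0, hm'₂, hm'₁⟩ : ∃ m' : ℝ, 0 < m' ∧ m' ≤ m₂ ∧ m' * N₂ < m₁ := by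
    refine ⟨min m₂ (m₁ / (2 * ((N₂ : ℝ) + 1))), lt_min hm₂ (by positivity), min_le_left _ _, ?_⟩
    have hN : (0 : ℝ) ≤ N₂ := Nat.cast_nonneg _
    have hpos : (0 : ℝ) < 2 * ((N₂ : ℝ) + 1) := by positivity
    have h1 : min m₂ (m₁ / (2 * ((N₂ : ℝ) + 1))) * N₂ ≤ m₁ / (2 * ((N₂ : ℝ) + 1)) * N₂ :=
      mul_le_mul_of_nonneg_right (min_le_right _ _) hN
    have h2 : m₁ / (2 * ((N₂ : ℝ) + 1)) * N₂ < m₁ := by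
      calc m₁ / (2 * ((N₂ : ℝ) + 1)) * N₂ < m₁ / (2 * ((N₂ : ℝ) + 1)) * (2 * ((N₂ : ℝ) + 1)) :=
            mul_lt_mul_of_pos_left (by linarith) (div_pos hm₁ hpos)
        _ = m₁ := div_mul_cancel₀ _ hpos.ne'
    exact h1.trans_lt h2
  -- the composite legs are localised at rate `m'`
  have hR : LegDecay (legComp r₂ r₁) (N₂ * N₁) ((d + 1 : ℕ) * (Cr₁ * Cr₂ * Zl (d + 1) (m₁ - m' * N₂))) m' :=
    legDecay_legComp hr₁ hr₂ hm'0.le hm'₂ hm'₁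
  have hL : LegDecay (legComp l₂ l₁) (N₂ * N₁) ((d + 1 : ℕ) * (Cl₁ * Cl₂ * Zl (d + 1) (m₁ - m' * N₂))) m' :=
    legDecay_legComp hl₁ hl₂ hm'0.le hm'₂ hm'₁
  -- a working rate for the middle kernel
  obtain ⟨δW, hδW0, hδWδ, hδWm⟩ : ∃ δW : ℝ, 0 < δW ∧ δW ≤ δ ∧ 3 * δW < m' := by
    refine ⟨min δ (m' / 4), lt_min hδ (by positivity), min_le_left _ _, ?_⟩
    have := min_le_right δ (m' / 4); linarith
  -- the middle kernel `W := vertex2W R X μ y ν y′` is bi-localised at the composite dilated point at rate `δW`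
  set W := vertex2W (legComp r₂ r₁) X μ y ν y' with hWdef
  have hW := biLoc_vertex2W_keep hR (hX.mono hδWδ) hδW0.le hδWm μ y ν y'
  -- table legs, then kernel legs
  rw [push₄_def l₁ r₁, vertex2W_push₄ hr₁ hl₂ hr₂ hm₁ hm₂ hX hδ μ y ν y', sandwich_ffRead, push₄_def]
  exact congrArg ffRead (sandwich_nest hl₁ hr₁ hl₂ hr₂ hm₁ hm₂ hL hW hδW0 (by linarith) (by linarith))

end Summit.QuantumFields.BalabanUV.Beta.GAN24.Push4Nest

end
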